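import Summits.SmoothPoincare4.SmoothPoincare4.Theorems.SymplecticOrigamiOrigamiFoldExistenceStubCleanOnePleatIroningRadial
import Literature.Topology.FourManifolds.FrameSignsAlongPaths
import Mathlib.LinearAlgebra.Determinant
import Mathlib.Topology.Instances.Matrix

/-!
# Stub `stub_cleanOnePleatIroning` of line `shadow-pleats` for crux `OrigamiFoldExistence` — VIII:
# the Jacobian changes sign across a Whitney fold
(item stmt-SmoothPoincare4-7844, route SymplecticOrigami; seat c3, S5a worker, wave 2)

Eighth helper file for the registered stub `stub_cleanOnePleatIroning` (S5a), the orientation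
count of step (T1) (the SIDE on which the chart collar meets the crease) of its remaining
ingredient `CleanPleatIroningChart` (file III).  For a smooth `G : ℝ⁴ → ℝ⁴`:

* `det_fderiv_mul_pos_of_isPreconnected` — on a preconnected set where `dG` is injective the
  Jacobian determinant `det dG` has constant sign (it is continuous and zero-free);
* `tendsto_inv_mul_det_fderiv_fold` — **the Jacobian changes sign across a Whitney fold**:
  at a fold point `u₀ = r e₀` with kernel vector `v` (`dG(u₀) v = 0`, fold condition
  `D²G(u₀)[v,v] ∉ range dG(u₀)`, kernel transverse to the sphere), `t⁻¹ det dG(u₀ + t v)`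
  tends to a NON-ZERO limit as `t → 0` — by multilinearity of the determinant in the adapted
  basis `(v, e₁, e₂, e₃)`: the `v`-column of `dG(u₀ + t v)` is `t (D²G(u₀)[v,v] + o(1))`, and
  `(D²G(u₀)[v,v], dG(u₀) e₁, dG(u₀) e₂, dG(u₀) e₃)` is a basis (registered sub-goal); corollary
  `exists_det_fderiv_mul_neg_fold`: opposite signs at `u₀ ± t v` for small `t > 0`;
* `isPreconnected_openShell` — open shells `{a < |u| < b}` of `ℝ⁴` are preconnected.
The application to the chart shadow of a single pleat (same sign of `det dG` on the open hole
and on the open collar — two sign changes; the orientation input of the side determination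
(T1)) is the sequel file `…StubCleanOnePleatIroningSignsPleat`.

Sources: M. Golubitsky, V. Guillemin, *Stable mappings and their singularities* (1973), Ch. III
§4 (fold normal form: the Jacobian has a simple zero along the fold); file IV (`…FoldKernel`).
-/

noncomputable section

-- the prescribed namespace `Summit.<P>.<Sub>.…` duplicates `SmoothPoincare4` (P = Sub)
set_option linter.dupNamespace false

open scoped Manifold ContDiff Topology RealInnerProductSpace
open Set Function Filter Metric Module

namespace Summit.SmoothPoincare4.SmoothPoincare4.Theorems.OrigamiFoldExistence.ShadowPleats

/-! ### Constant sign of the Jacobian on preconnected immersive sets -/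

section Sign

variable {G : EuclideanSpace ℝ (Fin 4) → EuclideanSpace ℝ (Fin 4)}

/-- The Jacobian determinant of a `C^∞` map is continuous. -/
theorem continuous_det_fderiv (hG : ContDiff ℝ ∞ G) :
    Continuous fun u => (fderiv ℝ G u).det :=
  ContinuousLinearMap.continuous_det.comp (hG.continuous_fderiv (by simp))

/-- **On a preconnected set where `dG` is injective, `det dG` has constant sign**: the product
of the determinants at any two points is positive. [folklore] -/
theorem det_fderiv_mul_pos_of_isPreconnected (hG : ContDiff ℝ ∞ G)
    {S : Set (EuclideanSpace ℝ (Fin 4))} (hS : IsPreconnected S)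
    (hinj : ∀ u ∈ S, Injective (fderiv ℝ G u)) {a b : EuclideanSpace ℝ (Fin 4)} (ha : a ∈ S)
    (hb : b ∈ S) : 0 < (fderiv ℝ G a).det * (fderiv ℝ G b).det := by
  have hne : ∀ u ∈ S, (fderiv ℝ G u).det ≠ 0 := fun u hu =>
    Literature.Topology.FourManifolds.det_ne_zero_of_injective (hinj u hu)
  have hcont : ContinuousOn (fun u => (fderiv ℝ G u).det) S := (continuous_det_fderiv hG).continuousOn
  -- no zero between the two values
  have key : ∀ {a b}, a ∈ S → b ∈ S → ¬ ((fderiv ℝ G a).det < 0 ∧ 0 < (fderiv ℝ G b).det) := by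
    rintro a b ha hb ⟨h1, h2⟩
    obtain ⟨c, hc, hc0⟩ := hS.intermediate_value ha hb hcont ⟨h1.le, h2.le⟩
    exact hne c hc hc0
  rcases (hne a ha).lt_or_gt with h1 | h1 <;> rcases (hne b hb).lt_or_gt with h2 | h2
  · exact mul_pos_of_neg_of_neg h1 h2
  · exact absurd ⟨h1, h2⟩ (key ha hb)
  · exact absurd ⟨h2, h1⟩ (key hb ha)
  · exact mul_pos h1 h2

/-- The open shell `{a < |u| < b}` of `ℝ⁴` (`a > 0`) is preconnected: it is the image of
`sphere × (a, b)` under `(x, r) ↦ r • x`. [folklore] -/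
-- adapted from `isPreconnected_openAnnulus` (Literature/Geometry/Lorentzian/MassCapacityRigidityHarmonic.lean)
theorem isPreconnected_openShell {a b : ℝ} (ha : 0 < a) :
    IsPreconnected {u : EuclideanSpace ℝ (Fin 4) | a < ‖u‖ ∧ ‖u‖ < b} := by
  have himage : {u : EuclideanSpace ℝ (Fin 4) | a < ‖u‖ ∧ ‖u‖ < b} =
      (fun p : EuclideanSpace ℝ (Fin 4) × ℝ => p.2 • p.1) ''
        (sphere (0 : EuclideanSpace ℝ (Fin 4)) 1 ×ˢ Ioo a b) := by
    ext x
    simp only [mem_setOf_eq, mem_image, mem_prod, mem_sphere_zero_iff_norm, mem_Ioo, Prod.exists]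
    constructor
    · rintro ⟨ha', hb'⟩
      have hx0 : 0 < ‖x‖ := ha.trans ha'
      refine ⟨‖x‖⁻¹ • x, ‖x‖, ⟨?_, ha', hb'⟩, ?_⟩
      · rw [norm_smul, norm_inv, norm_norm, inv_mul_cancel₀ hx0.ne']
      · rw [smul_smul, mul_inv_cancel₀ hx0.ne', one_smul]
    · rintro ⟨y, r, ⟨hy, har, hrb⟩, rfl⟩
      have hr : 0 < r := ha.trans har
      rw [norm_smul, Real.norm_of_nonneg hr.le, hy, mul_one]
      exact ⟨har, hrb⟩
  rw [himage]
  have hE : 1 < Module.rank ℝ (EuclideanSpace ℝ (Fin 4)) :=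
    Module.one_lt_rank_of_one_lt_finrank (by rw [finrank_euclideanSpace_fin]; norm_num)
  exact ((isPreconnected_sphere hE 0 1).prod isPreconnected_Ioo).image _
    (continuous_snd.smul continuous_fst).continuousOn

end Sign

/-! ### The Jacobian changes sign across a Whitney fold -/

section Fold

/-- **The adapted frame is linearly independent.**  At a fold point on the `e₀`-axis the
ADAPTED FRAME is the kernel vector `v` followed by the coordinate vectors `e₁, e₂, e₃` (tangent
to the round sphere through `r e₀`); it is linearly independent as soon as `v 0 ≠ 0`. -/
theorem linearIndependent_foldFrame {v : EuclideanSpace ℝ (Fin 4)} (hv : v 0 ≠ 0) :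
    LinearIndependent ℝ
      (fun j : Fin 4 => if j = 0 then v else EuclideanSpace.single j (1 : ℝ)) := by
  rw [Fintype.linearIndependent_iff]
  intro g hg
  have hc : ∀ i : Fin 4,
      (∑ j, g j • (fun j : Fin 4 => if j = 0 then v else EuclideanSpace.single j (1 : ℝ)) j) i = 0 :=
    fun i => by rw [hg]; rfl
  have h0 := hc 0
  have h1 := hc 1
  have h2 := hc 2
  have h3 := hc 3
  simp only [Fin.sum_univ_four, Fin.isValue, if_true, show (1 : Fin 4) ≠ 0 by decide,
    show (2 : Fin 4) ≠ 0 by decide, show (3 : Fin 4) ≠ 0 by decide, if_false,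
    PiLp.add_apply, PiLp.smul_apply, PiLp.single_apply, smul_eq_mul] at h0 h1 h2 h3
  simp only [Fin.isValue, show (0 : Fin 4) ≠ 1 by decide, show (0 : Fin 4) ≠ 2 by decide,
    show (0 : Fin 4) ≠ 3 by decide, show (1 : Fin 4) ≠ 2 by decide, show (1 : Fin 4) ≠ 3 by decide,
    show (2 : Fin 4) ≠ 1 by decide, show (2 : Fin 4) ≠ 3 by decide, show (3 : Fin 4) ≠ 1 by decide,
    show (3 : Fin 4) ≠ 2 by decide, if_false, mul_zero, mul_one, add_zero] at h0 h1 h2 h3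
  have hg0 : g 0 = 0 := by
    rcases mul_eq_zero.1 h0 with h | h
    · exact h
    · exact absurd h hv
  rw [hg0, zero_mul, zero_add] at h1 h2 h3
  intro i
  fin_cases i
  · exact hg0
  · exact h1
  · exact h2
  · exact h3

/-- The determinant form of a basis of `ℝ⁴` is continuous in the four vectors. -/
theorem continuous_basis_det (b : Basis (Fin 4) ℝ (EuclideanSpace ℝ (Fin 4))) :
    Continuous fun w : Fin 4 → EuclideanSpace ℝ (Fin 4) => b.det w := by
  have h : (fun w : Fin 4 → EuclideanSpace ℝ (Fin 4) => b.det w) = fun w => (b.toMatrix w).det :=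
    funext fun w => b.det_apply w
  rw [h]
  refine Continuous.matrix_det ?_
  refine continuous_matrix fun i j => ?_
  have : (fun w : Fin 4 → EuclideanSpace ℝ (Fin 4) => b.toMatrix w i j) = fun w => b.coord i (w j) := by
    funext w
    rfl
  rw [this]
  exact (b.coord i).continuous_of_finiteDimensional.comp (continuous_apply j)

/-- The determinant of an endomorphism is the determinant form of the images of a basis. -/
theorem det_eq_basis_det (b : Basis (Fin 4) ℝ (EuclideanSpace ℝ (Fin 4)))
    (A : EuclideanSpace ℝ (Fin 4) →L[ℝ] EuclideanSpace ℝ (Fin 4)) :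
    A.det = b.det (fun i => A (b i)) := by
  have h := b.det_comp (A : EuclideanSpace ℝ (Fin 4) →ₗ[ℝ] EuclideanSpace ℝ (Fin 4)) b
  rw [b.det_self, mul_one] at h
  change LinearMap.det (A : EuclideanSpace ℝ (Fin 4) →ₗ[ℝ] EuclideanSpace ℝ (Fin 4)) = _
  rw [← h]
  rfl

variable {G : EuclideanSpace ℝ (Fin 4) → EuclideanSpace ℝ (Fin 4)}

/-- **The Jacobian of a smooth map has a SIMPLE zero across a Whitney fold.**  Let `u₀` lie
on the `e₀`-axis, `v` a kernel vector of `dG(u₀)` transverse to `e₀ᗮ` (`v 0 ≠ 0`) with the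
fold condition `D²G(u₀)[v,v] ∉ range dG(u₀)`, and suppose the kernel of `dG(u₀)` meets `u₀ᗮ`
trivially.  Then `t⁻¹ · det dG(u₀ + t v)` has a non-zero limit as `t → 0`; in particular
`det dG` takes opposite signs at `u₀ + t v` and `u₀ - t v` for small `t ≠ 0`. [folklore] -/
theorem tendsto_inv_mul_det_fderiv_fold (hG : ContDiff ℝ ∞ G) {u₀ v : EuclideanSpace ℝ (Fin 4)}
    (hu₀ : ∀ j : Fin 4, j ≠ 0 → u₀ j = 0) (hv0 : v 0 ≠ 0) (hker : fderiv ℝ G u₀ v = 0)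
    (hfold : fderiv ℝ (fun w => fderiv ℝ G w v) u₀ v ∉
      LinearMap.range (fderiv ℝ G u₀).toLinearMap)
    (htrans : ∀ w : EuclideanSpace ℝ (Fin 4), ⟪u₀, w⟫ = 0 → fderiv ℝ G u₀ w = 0 → w = 0) :
    ∃ c : ℝ, c ≠ 0 ∧
      Tendsto (fun t : ℝ => t⁻¹ * (fderiv ℝ G (u₀ + t • v)).det) (𝓝[≠] 0) (𝓝 c) := by
  -- the adapted basis `(v, e₁, e₂, e₃)`
  have hli := linearIndependent_foldFrame hv0
  have hcard : Fintype.card (Fin 4) = finrank ℝ (EuclideanSpace ℝ (Fin 4)) := by simp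
  set b : Basis (Fin 4) ℝ (EuclideanSpace ℝ (Fin 4)) :=
    basisOfLinearIndependentOfCardEqFinrank hli hcard with hb_def
  have hb : ⇑b = fun j : Fin 4 => if j = 0 then v else EuclideanSpace.single j (1 : ℝ) :=
    coe_basisOfLinearIndependentOfCardEqFinrank hli hcard
  have hb0 : b 0 = v := by rw [hb]; exact if_pos rfl
  have hbj : ∀ j : Fin 4, j ≠ 0 → b j = EuclideanSpace.single j 1 := fun j hj => by
    rw [hb]; exact if_neg hj
  -- the path of differentials
  set A : ℝ → EuclideanSpace ℝ (Fin 4) →L[ℝ] EuclideanSpace ℝ (Fin 4) :=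
    fun t => fderiv ℝ G (u₀ + t • v) with hA
  have hA0 : A 0 = fderiv ℝ G u₀ := by simp [hA]
  have hAcont : Continuous A :=
    (hG.continuous_fderiv (by simp)).comp (continuous_const.add (continuous_id.smul continuous_const))
  set q : EuclideanSpace ℝ (Fin 4) := fderiv ℝ (fun w => fderiv ℝ G w v) u₀ v with hq
  -- the `v`-column vanishes at `t = 0` with velocity `q`
  have hcol : HasDerivAt (fun t : ℝ => A t v) q 0 := by
    have hφ : ContDiff ℝ ∞ fun w => fderiv ℝ G w v :=
      (hG.fderiv_right (m := ∞) (by simp)).clm_apply contDiff_const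
    have hφd : HasFDerivAt (fun w => fderiv ℝ G w v)
        (fderiv ℝ (fun w => fderiv ℝ G w v) (u₀ + (0 : ℝ) • v)) (u₀ + (0 : ℝ) • v) :=
      ((hφ.differentiable (by simp)) _).hasFDerivAt
    have hline : HasDerivAt (fun t : ℝ => u₀ + t • v) ((1 : ℝ) • v) 0 :=
      ((hasDerivAt_id (0 : ℝ)).smul_const v).const_add u₀
    have h := hφd.comp_hasDerivAt (0 : ℝ) hline
    have h0 : u₀ + (0 : ℝ) • v = u₀ := by simp
    rw [h0, one_smul] at h
    exact h
  have hA0v : A 0 v = 0 := by rw [hA0, hker]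
  have hslope : Tendsto (fun t : ℝ => t⁻¹ • A t v) (𝓝[≠] 0) (𝓝 q) := by
    have h := hcol.tendsto_slope_zero
    simp only [zero_add, hA0v, sub_zero] at h
    exact h
  -- the column family and its limit
  set V : ℝ → Fin 4 → EuclideanSpace ℝ (Fin 4) :=
    fun t => update (fun i => A t (b i)) 0 (t⁻¹ • A t v) with hV
  set V₀ : Fin 4 → EuclideanSpace ℝ (Fin 4) := update (fun i => A 0 (b i)) 0 q with hV₀
  have hVt : Tendsto V (𝓝[≠] 0) (𝓝 V₀) := by
    have h1 : Tendsto (fun t : ℝ => fun i => A t (b i)) (𝓝[≠] 0) (𝓝 fun i => A 0 (b i)) := by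
      refine tendsto_pi_nhds.2 fun i => ?_
      have hc : Continuous fun t : ℝ => A t (b i) := hAcont.clm_apply continuous_const
      exact (hc.tendsto 0).mono_left nhdsWithin_le_nhds
    exact h1.update 0 hslope
  -- the determinant identity for `t ≠ 0`
  have hdet : ∀ t : ℝ, t ≠ 0 → t⁻¹ * (A t).det = b.det (V t) := by
    intro t ht
    rw [det_eq_basis_det b (A t)]
    have hfun : (fun i => A t (b i)) = update (fun i => A t (b i)) 0 (t • (t⁻¹ • A t v)) := by
      rw [smul_inv_smul₀ ht, ← hb0]
      exact (update_eq_self 0 _).symm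
    rw [hfun, (b.det).map_update_smul, hV, smul_eq_mul, ← mul_assoc, inv_mul_cancel₀ ht, one_mul]
  have hlim : Tendsto (fun t => b.det (V t)) (𝓝[≠] 0) (𝓝 (b.det V₀)) :=
    ((continuous_basis_det b).tendsto V₀).comp hVt
  refine ⟨b.det V₀, ?_, hlim.congr' ?_⟩
  · -- `V₀ = (q, dG e₁, dG e₂, dG e₃)` is a basis
    have hV₀0 : V₀ 0 = q := by rw [hV₀, update_self]
    have hV₀j : ∀ j : Fin 4, j ≠ 0 → V₀ j = fderiv ℝ G u₀ (EuclideanSpace.single j 1) := by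
      intro j hj
      rw [hV₀, update_of_ne hj, hA0, hbj j hj]
    have hliV : LinearIndependent ℝ V₀ := by
      rw [Fintype.linearIndependent_iff]
      intro g hg
      set z : EuclideanSpace ℝ (Fin 4) := g 1 • EuclideanSpace.single 1 1 +
        g 2 • EuclideanSpace.single 2 1 + g 3 • EuclideanSpace.single 3 1 with hz
      have hsum : g 0 • q + fderiv ℝ G u₀ z = 0 := by
        rw [← hg, Fin.sum_univ_four, hV₀0, hV₀j 1 (by decide), hV₀j 2 (by decide),
          hV₀j 3 (by decide), hz, map_add, map_add, map_smul, map_smul, map_smul]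
        abel
      have hz0 : z 0 = 0 := by simp [hz]
      have hzorth : ⟪u₀, z⟫ = 0 := by
        rw [PiLp.inner_apply, Fin.sum_univ_four, hu₀ 1 (by decide), hu₀ 2 (by decide),
          hu₀ 3 (by decide), hz0]
        simp
      have hg0 : g 0 = 0 := by
        by_contra hne
        apply hfold
        refine ⟨-(g 0)⁻¹ • z, ?_⟩
        rw [ContinuousLinearMap.coe_coe, map_smul]
        have : fderiv ℝ G u₀ z = -(g 0 • q) := eq_neg_of_add_eq_zero_right hsum
        rw [this, smul_neg, neg_smul, neg_neg, smul_smul, inv_mul_cancel₀ hne, one_smul]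
      rw [hg0, zero_smul, zero_add] at hsum
      have hzz : z = 0 := htrans z hzorth hsum
      have hz1 : z 1 = g 1 := by simp [hz]
      have hz2 : z 2 = g 2 := by simp [hz]
      have hz3 : z 3 = g 3 := by simp [hz]
      rw [hzz, PiLp.zero_apply] at hz1 hz2 hz3
      intro i
      fin_cases i
      · exact hg0
      · exact hz1.symm
      · exact hz2.symm
      · exact hz3.symm
    have hspan := hliV.span_eq_top_of_card_eq_finrank' hcard
    exact ((b.is_basis_iff_det).1 ⟨hliV, hspan⟩).ne_zero
  · filter_upwards [self_mem_nhdsWithin] with t ht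
    exact (hdet t ht).symm

/-- **Opposite signs on the two sides of a fold**: under the hypotheses of
`tendsto_inv_mul_det_fderiv_fold`, for every `τ > 0` there is `t ∈ (0, τ)` with
`det dG(u₀ + t v) · det dG(u₀ - t v) < 0`. [folklore] -/
theorem exists_det_fderiv_mul_neg_fold (hG : ContDiff ℝ ∞ G) {u₀ v : EuclideanSpace ℝ (Fin 4)}
    (hu₀ : ∀ j : Fin 4, j ≠ 0 → u₀ j = 0) (hv0 : v 0 ≠ 0) (hker : fderiv ℝ G u₀ v = 0)
    (hfold : fderiv ℝ (fun w => fderiv ℝ G w v) u₀ v ∉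
      LinearMap.range (fderiv ℝ G u₀).toLinearMap)
    (htrans : ∀ w : EuclideanSpace ℝ (Fin 4), ⟪u₀, w⟫ = 0 → fderiv ℝ G u₀ w = 0 → w = 0)
    {τ : ℝ} (hτ : 0 < τ) :
    ∃ t : ℝ, 0 < t ∧ t < τ ∧
      (fderiv ℝ G (u₀ + t • v)).det * (fderiv ℝ G (u₀ + (-t) • v)).det < 0 := by
  obtain ⟨c, hc, hlim⟩ := tendsto_inv_mul_det_fderiv_fold hG hu₀ hv0 hker hfold htrans
  -- eventually `c · t⁻¹ det dG(u₀ + t v) > 0` on the punctured neighbourhood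
  have hpos : ∀ᶠ t in 𝓝[≠] (0 : ℝ), 0 < c * (t⁻¹ * (fderiv ℝ G (u₀ + t • v)).det) := by
    have hcc : 0 < c * c := mul_self_pos.2 hc
    have hev : ∀ᶠ t in 𝓝[≠] (0 : ℝ), c * c / 2 < c * (t⁻¹ * (fderiv ℝ G (u₀ + t • v)).det) :=
      (hlim.const_mul c).eventually (eventually_gt_nhds (by linarith))
    filter_upwards [hev] with t ht
    linarith
  -- symmetrise: the punctured neighbourhood is invariant under `t ↦ -t`
  have hneg : ∀ᶠ t in 𝓝[≠] (0 : ℝ), 0 < c * ((-t)⁻¹ * (fderiv ℝ G (u₀ + (-t) • v)).det) := by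
    have ht : Tendsto (fun t : ℝ => -t) (𝓝[≠] 0) (𝓝[≠] 0) := by
      have h1 : Tendsto (fun t : ℝ => -t) (𝓝 (0 : ℝ)) (𝓝 0) := by
        simpa using (continuous_neg.tendsto (0 : ℝ))
      refine h1.inf ?_
      rw [tendsto_principal_principal]
      intro t ht
      simpa using ht
    exact ht.eventually hpos
  have hsmall : ∀ᶠ t in 𝓝[≠] (0 : ℝ), t < τ :=
    mem_nhdsWithin_of_mem_nhds (Iio_mem_nhds hτ)
  have hgt : ∀ᶠ t in 𝓝[>] (0 : ℝ), 0 < t := self_mem_nhdsWithin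
  obtain ⟨t, ⟨⟨h1, h2⟩, h3⟩, h4⟩ :=
    (((hpos.and hneg).and hsmall).filter_mono (nhdsGT_le_nhdsNE 0) |>.and hgt).exists
  refine ⟨t, h4, h3, ?_⟩
  have ht0 : t ≠ 0 := h4.ne'
  -- signs: `c t⁻¹ d₊ > 0`, `c (-t)⁻¹ d₋ > 0` with `t > 0` give `c d₊ > 0 > c d₋`
  have hd1 : 0 < c * (fderiv ℝ G (u₀ + t • v)).det := by
    have := mul_pos h1 h4
    calc 0 < c * (t⁻¹ * (fderiv ℝ G (u₀ + t • v)).det) * t := this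
      _ = c * (fderiv ℝ G (u₀ + t • v)).det := by field_simp
  have hd2 : c * (fderiv ℝ G (u₀ + (-t) • v)).det < 0 := by
    have := mul_pos h2 h4
    have h' : c * ((-t)⁻¹ * (fderiv ℝ G (u₀ + (-t) • v)).det) * t =
        -(c * (fderiv ℝ G (u₀ + (-t) • v)).det) := by
      rw [inv_neg]
      field_simp
    linarith [h'.symm ▸ this]
  nlinarith [mul_pos_iff.1 hd1, hd2, sq_nonneg c]

end Fold

end Summit.SmoothPoincare4.SmoothPoincare4.Theorems.OrigamiFoldExistence.ShadowPleats

end
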